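import Summits.Ventures.PercRepro.S1TriangleKernelSevenCases
import Summits.Ventures.PercRepro.S1TriangleKernelSevenThirteen

/-!
# PercRepro — THE TRIANGLE KERNEL AT NULLITY `7`: `s₃ ≤ 12` under (C1), (C2) and (C3) (p8, gen 24; a feeder for S4 —
the rows `≤ 36` of the `q = 7` window)

From the kernel `s₃ ≤ 10` at nullity `6` (S1TriangleKernelSix), at the point `x` on the fewest triangles (`m := t_x`):
`s₃ ≤ m + 10` (the kernel on `M ＼ {x}`) and `m + 2m² ≤ 3 s₃`, so `s₃ ≥ 13` forces `3 ≤ m ≤ 4`; the restriction step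
(`ncard_sUnion_triangles_of_thirteen`) gives `|U| = r(U) + 7 ≥ 12` for `U = ⋃ triangles`, which rules out `m = 4`
(`|U|·4 ≤ 3·14`), so `m = 3`, `s₃ = 13`, `|U| ∈ {12, 13}`, `r(U) = |U| − 7`. With `Q = U ∖ St` (the star `St` of `x`,
`7` points, rank `4`): if no point of `Q` lies in `cl(St)`, the star-incidence count kills it
(`false_of_forall_notMem_closure_star`: `12` triangles avoiding `x` against `10`); otherwise the cases `|U| = 12`
(`false_of_twelve`) and `|U| = 13` (`false_of_thirteen`). Hence **`s₃ ≤ 12` at nullity `7`**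
(`kernelSeven_ncard_triangles_le_twelve`); with the kernel at nullity `6` and the (C3)-refined bootstrap step this
gives `15` at nullity `8` against `18`. Axioms: standard.
-/

open scoped Matroid

namespace PercRepro

namespace S1

open Set

variable {α : Type}

/-- **THE TRIANGLE KERNEL AT NULLITY `7`.** If `|E| = r(E) + 7`, every rank-`2` set has at most `3` elements (C1), every
rank-`≤ 3` set at most `6` (C2) and every rank-`≤ 4` set at most `10` (C3), then `#(triangles M) ≤ 12`. -/
theorem kernelSeven_ncard_triangles_le_twelve (M : Matroid α) [M.Finite]
    (hC1 : ∀ L ⊆ M.E, M.eRk L = 2 → L.ncard ≤ 3)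
    (hC2 : ∀ X ⊆ M.E, M.eRk X ≤ 3 → X.ncard ≤ 6)
    (hC3 : ∀ X ⊆ M.E, M.eRk X ≤ 4 → X.ncard ≤ 10)
    (hd : M.E.encard = M.eRank + 7) : (ThmN.triangles M).ncard ≤ 12 := by
  classical
  set S := ThmN.triangles M with hS
  have hSfin : S.Finite :=
    M.ground_finite.finite_subsets.subset (fun C hC => hC.1.subset_ground)
  by_cases hSe : S = ∅
  · rw [hSe, ncard_empty]; exact Nat.zero_le _
  -- the point on the fewest triangles
  have hUE : ⋃₀ S ⊆ M.E := by
    intro z hz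
    obtain ⟨C, hC, hzC⟩ := Set.mem_sUnion.1 hz
    exact hC.1.subset_ground hzC
  have hUfin : (⋃₀ S).Finite := M.ground_finite.subset hUE
  set Uf : Finset α := hUfin.toFinset with hUf
  have hmemU : ∀ x, x ∈ Uf ↔ x ∈ ⋃₀ S := fun x => Set.Finite.mem_toFinset hUfin
  have hUne : Uf.Nonempty := by
    obtain ⟨C₀, hC₀⟩ := nonempty_iff_ne_empty.2 hSe
    obtain ⟨e, heC₀⟩ := hC₀.1.nonempty
    exact ⟨e, (hmemU e).2 (Set.mem_sUnion.2 ⟨C₀, hC₀, heC₀⟩)⟩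
  obtain ⟨x, hxU, hxmin⟩ := Finset.exists_min_image Uf (fun y => (ThmN.trianglesThrough M y).ncard) hUne
  have hxU' : x ∈ ⋃₀ S := (hmemU x).1 hxU
  obtain ⟨C₀, hC₀, hxC₀⟩ := Set.mem_sUnion.1 hxU'
  set m := (ThmN.trianglesThrough M x).ncard with hm
  have hmin : ∀ y ∈ ⋃₀ ThmN.triangles M, m ≤ (ThmN.trianglesThrough M y).ncard :=
    fun y hy => hxmin y ((hmemU y).2 hy)
  have heE : x ∈ M.E := hC₀.1.subset_ground hxC₀
  have hne : ¬ M.IsColoop x := hC₀.1.not_isColoop_of_mem hxC₀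
  have hx : M.IsNonloop x := by
    refine _root_.Matroid.isNonloop_of_not_isLoop heE ?_
    intro hloop
    have hC₀e : C₀ = {x} := hloop.eq_of_isCircuit_mem hC₀.1 hxC₀
    have := hC₀.2
    rw [hC₀e, ncard_singleton] at this
    omega
  -- the nullity of `M ＼ {x}` is `6`
  have hν : M✶.eRank = (7 : ℕ∞) := by
    have h := _root_.Matroid.eRank_add_eRank_dual M
    rw [hd] at h
    exact WithTop.add_left_cancel (PercRepro.Matroid.eRank_ne_top_of_finite M) h
  have hdel := PercRepro.Matroid.dual_eRank_delete_singleton_add_one heE hne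
  rw [hν] at hdel
  have hfin' : (M ＼ {x})✶.eRank ≠ ⊤ := by
    intro h
    rw [h] at hdel
    exact absurd hdel (by simp)
  obtain ⟨d', hd'⟩ := ENat.ne_top_iff_exists.1 hfin'
  have hdd' : d' + 1 = 7 := by
    rw [← hd'] at hdel
    exact_mod_cast hdel
  have hd'6 : d' = 6 := by omega
  have hd'enc : (M ＼ {x}).E.encard = (M ＼ {x}).eRank + d' := by
    have h := _root_.Matroid.eRank_add_eRank_dual (M ＼ {x})
    rw [← hd'] at h
    exact h.symm
  have hC1' : ∀ L ⊆ (M ＼ {x}).E, (M ＼ {x}).eRk L = 2 → L.ncard ≤ 3 := by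
    intro L hL hr
    rw [_root_.Matroid.delete_ground] at hL
    rw [delete_singleton_eRk_eq hL] at hr
    exact hC1 L (hL.trans sdiff_subset) hr
  have hC2' : ∀ X ⊆ (M ＼ {x}).E, (M ＼ {x}).eRk X ≤ 3 → X.ncard ≤ 6 := by
    intro X hX hr
    rw [_root_.Matroid.delete_ground] at hX
    rw [delete_singleton_eRk_eq hX] at hr
    exact hC2 X (hX.trans sdiff_subset) hr
  have hC3' : ∀ X ⊆ (M ＼ {x}).E, (M ＼ {x}).eRk X ≤ 4 → X.ncard ≤ 10 := by
    intro X hX hr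
    rw [_root_.Matroid.delete_ground] at hX
    rw [delete_singleton_eRk_eq hX] at hr
    exact hC3 X (hX.trans sdiff_subset) hr
  -- (a) `s₃ ≤ m + 10`: the kernel at nullity `6` on `M ＼ {x}`
  set S₁ := ThmN.trianglesThrough M x with hS₁
  set S₂ := {C | M.IsCircuit C ∧ C.ncard = 3 ∧ x ∉ C} with hS₂
  have hsplit : S ⊆ S₁ ∪ S₂ := by
    intro C hC
    by_cases h : x ∈ C
    · exact Or.inl ⟨hC.1, hC.2, h⟩
    · exact Or.inr ⟨hC.1, hC.2, h⟩
  have hS₁fin : S₁.Finite := hSfin.subset (fun C hC => ⟨hC.1, hC.2.1⟩)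
  have hS₂fin : S₂.Finite := hSfin.subset (fun C hC => ⟨hC.1, hC.2.1⟩)
  have h3 : S.ncard ≤ S₁.ncard + S₂.ncard :=
    (ncard_le_ncard hsplit (hS₁fin.union hS₂fin)).trans (ncard_union_le _ _)
  have hsub : S₂ ⊆ ThmN.triangles (M ＼ {x}) := by
    intro C hC
    exact ⟨_root_.Matroid.delete_isCircuit_iff.2 ⟨hC.1, disjoint_singleton_right.2 hC.2.2⟩, hC.2.1⟩
  have hS₂ : S₂.ncard ≤ 10 := by
    rw [hd'6] at hd'enc
    exact (ncard_le_ncard hsub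
      ((M ＼ {x}).ground_finite.finite_subsets.subset (fun C hC => hC.1.subset_ground))).trans
      (kernelSix_ncard_triangles_le_ten (M ＼ {x}) hC1' hC2' hC3' (by exact_mod_cast hd'enc))
  have ha : S.ncard ≤ m + 10 := by omega
  -- (b) the star and the double count
  have hstar : 1 + 2 * m ≤ (⋃₀ S).ncard := one_add_two_mul_ncard_trianglesThrough_le M hC1 hx hxU'
  have hdc : (⋃₀ S).ncard * m ≤ 3 * S.ncard := ncard_sUnion_mul_le_three_mul_ncard_triangles M hmin
  have hb : m + 2 * m * m ≤ 3 * S.ncard := by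
    have h1 : (1 + 2 * m) * m ≤ (⋃₀ S).ncard * m := Nat.mul_le_mul_right m hstar
    have h2 : (1 + 2 * m) * m = m + 2 * m * m := by ring
    rw [h2] at h1
    exact h1.trans hdc
  -- (c) if `s₃ ≥ 13` then `m = 3`, `s₃ = 13`, `|U| ∈ {12, 13}` with `r(U) = |U| − 7`
  by_contra hcon
  have hs13 : 13 ≤ S.ncard := by omega
  have hm3 : 3 ≤ m := by omega
  have hm4 : m ≤ 4 := by nlinarith
  have hU7 : 7 ≤ (⋃₀ S).ncard := by omega
  obtain ⟨r, hr5, hrU, hUcard⟩ := ncard_sUnion_triangles_of_thirteen M hC1 hC2 hC3 hd hs13 hU7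
  rw [← hS] at hrU hUcard
  have hm3' : m = 3 := by
    rcases Nat.eq_or_lt_of_le hm4 with h4 | h4
    · exfalso
      rw [h4] at hdc ha
      omega
    · omega
  have hs13' : S.ncard = 13 := by omega
  have hU13 : (⋃₀ S).ncard ≤ 13 := by
    rw [hm3', hs13'] at hdc
    omega
  have hr6 : r ≤ 6 := by omega
  -- every point of `U` lies on at least `3` triangles
  have hmin3 : ∀ y ∈ ⋃₀ S, 3 ≤ (ThmN.trianglesThrough M y).ncard := by
    intro y hy
    have := hmin y hy
    omega
  -- (d) the star of `x`: `s = {C₁, C₂, C₃}`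
  set s : Finset (Set α) := hS₁fin.toFinset with hsdef
  have hs : ∀ C ∈ s, C ∈ ThmN.trianglesThrough M x :=
    fun C hC => (Set.Finite.mem_toFinset hS₁fin).1 hC
  have hs' : ∀ C, C ∈ ThmN.trianglesThrough M x → C ∈ s :=
    fun C hC => (Set.Finite.mem_toFinset hS₁fin).2 hC
  have hscard : s.card = 3 := by
    rw [hsdef, ← Set.ncard_eq_toFinset_card _ hS₁fin]
    exact hm3'
  obtain ⟨-, hstar_card⟩ := ThmN.eRk_le_and_ncard_eq_of_triangles M hC1 hx s hs
  rw [hscard] at hstar_card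
  obtain ⟨Ci, Cj, Ck, hij, hik, hjk, hs_eq⟩ := Finset.card_eq_three.1 hscard
  have hCi : Ci ∈ ThmN.trianglesThrough M x := hs Ci (by rw [hs_eq]; simp)
  have hCj : Cj ∈ ThmN.trianglesThrough M x := hs Cj (by rw [hs_eq]; simp)
  have hCk : Ck ∈ ThmN.trianglesThrough M x := hs Ck (by rw [hs_eq]; simp)
  have hmem3 : ∀ C, C ∈ ThmN.trianglesThrough M x → C = Ci ∨ C = Cj ∨ C = Ck := by
    intro C hC
    have := hs' C hC
    rw [hs_eq] at this
    simpa using this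
  set St := ({x} ∪ (Ci ∪ Cj ∪ Ck) : Set α) with hSt
  have hSteq : ({x} ∪ ⋃ C ∈ s, C) = St := by
    ext z
    constructor
    · intro hz
      rcases hz with hz | hz
      · exact Or.inl hz
      · obtain ⟨C, hC, hzC⟩ := Set.mem_iUnion₂.1 hz
        rw [hs_eq] at hC
        simp only [Finset.mem_insert, Finset.mem_singleton] at hC
        rcases hC with rfl | rfl | rfl
        · exact Or.inr (Or.inl (Or.inl hzC))
        · exact Or.inr (Or.inl (Or.inr hzC))
        · exact Or.inr (Or.inr hzC)
    · intro hz
      rcases hz with hz | hz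
      · exact Or.inl hz
      · refine Or.inr ?_
        rcases hz with (hz | hz) | hz
        · exact Set.mem_iUnion₂.2 ⟨Ci, by rw [hs_eq]; simp, hz⟩
        · exact Set.mem_iUnion₂.2 ⟨Cj, by rw [hs_eq]; simp, hz⟩
        · exact Set.mem_iUnion₂.2 ⟨Ck, by rw [hs_eq]; simp, hz⟩
  rw [hSteq] at hstar_card
  have hStU : St ⊆ ⋃₀ S := by
    intro z hz
    rcases hz with hz | hz
    · rw [Set.mem_singleton_iff.1 hz]; exact hxU'
    · rcases hz with (hz | hz) | hz
      · exact Set.mem_sUnion.2 ⟨Ci, ⟨hCi.1, hCi.2.1⟩, hz⟩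
      · exact Set.mem_sUnion.2 ⟨Cj, ⟨hCj.1, hCj.2.1⟩, hz⟩
      · exact Set.mem_sUnion.2 ⟨Ck, ⟨hCk.1, hCk.2.1⟩, hz⟩
  -- the ten triangles avoiding `x`
  have hS₂card : S₂.ncard = 10 := by
    have hS₁card : S₁.ncard = 3 := hm3'
    have hS₁S₂ : Disjoint S₁ S₂ := by
      rw [Set.disjoint_left]
      intro C hC hC'
      exact hC'.2.2 hC.2.2
    have hunion : S₁ ∪ S₂ = S := by
      ext C
      constructor
      · rintro (hC | hC)
        · exact ⟨hC.1, hC.2.1⟩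
        · exact ⟨hC.1, hC.2.1⟩
      · exact fun hC => hsplit hC
    have := Set.ncard_union_eq hS₁S₂ hS₁fin hS₂fin
    rw [hunion, hs13', hS₁card] at this
    omega
  have hQcard : ((⋃₀ S) \ St).ncard = (⋃₀ S).ncard - 7 := by
    rw [Set.ncard_sdiff' hStU hUfin, hstar_card]
  -- (e) the cases: no point of `Q` in `cl(St)`, or one such point with `|U| = 12` / `|U| = 13`
  by_cases hI : ∃ q₀ ∈ (⋃₀ S) \ St, q₀ ∈ M.closure St
  · obtain ⟨q₀, hq₀Q, hq₀cl⟩ := hI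
    rcases Nat.eq_or_lt_of_le hr5 with h5 | h6
    · -- `r(U) = 5`, `|U| = 12`
      have hU12 : (⋃₀ S).ncard = 12 := by omega
      have hQ5 : ((⋃₀ S) \ St).ncard = 5 := by rw [hQcard, hU12]
      have hr5' : M.eRk (⋃₀ S) = 5 := by rw [hrU, ← h5]; rfl
      exact false_of_twelve M hC1 hC2 hx hCi hCj hCk hij hik hjk hmem3 hmin3 hS₂card hQ5 hr5' hq₀Q hq₀cl
    · -- `r(U) = 6`, `|U| = 13`
      have hr6' : r = 6 := by omega
      have hU13' : (⋃₀ S).ncard = 13 := by omega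
      have hQ6 : ((⋃₀ S) \ St).ncard = 6 := by rw [hQcard, hU13']
      have hr6'' : M.eRk (⋃₀ S) = 6 := by rw [hrU, hr6']; rfl
      exact false_of_thirteen M hC1 hx hCi hCj hCk hij hik hjk hmin3 hQ6 hr6'' hq₀Q hq₀cl
  · push Not at hI
    exact false_of_forall_notMem_closure_star M hC1 hC2 hx hCi hCj hCk hij hik hjk hmem3 hmin3
      (by rw [hS₂card]; norm_num) hI

end S1

end PercRepro
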